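import Summits.Ventures.HodgeRepro2.T5RecordSatakeSevenDegreeOne
import Mathlib.NumberTheory.LSeries.PrimesInAP

/-!
# Infinitely many DEGREE-ONE places of `ℚ(ζ₇)⁺` stay prime in the field of record, by Dirichlet

Tier-5 support N3 / §G-N4.2 (seat p3, gen 79). Files 264–265 give, for every rational prime `p ≡ 6 (mod 7)`, three
places `v` of `ℚ(ζ₇)⁺` of norm `N(v) = p` that stay prime in `ℚ(ζ₇)`, with the record's Hecke algebra `k[T₁]`,
`deg T₁ = p⁴ + p`. Mathlib's Dirichlet theorem (`Nat.infinite_setOf_prime_and_eq_mod`, this pin) makes the family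
infinite, and a chosen place above each such `p` makes the infinitude of the places kernel-checked:

* `orderOf_six_zmod_seven`, `infinite_setOf_prime_and_orderOf_eq_two` — infinitely many primes `p ≡ 6 (mod 7)`
  (order `2`);
* `primeAbove`, `vDegOneOf`, `liesOver_vDegOneOf`, `absNorm_vDegOneOf`, `vDegOneOf_injective` — a chosen place of
  `ℚ(ζ₇)⁺` above each such `p`, of norm `p`, pairwise distinct;
* **`infinite_setOf_staysPrime_and_absNorm_prime`** — infinitely many places of `ℚ(ζ₇)⁺` of PRIME norm stay prime in
  `ℚ(ζ₇)` (the degree-one inert places);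
* **`infinite_setOf_nonempty_algEquiv_polynomial_and_absNorm_prime`** — at infinitely many places `v` of `ℚ(ζ₇)⁺` of
  prime norm the record's spherical Hecke algebra `H(U(1 ⊗ H₀), K_v)` is `k[X]` (for every family `l` of
  generators), with `deg T₁ = N(v)⁴ + N(v)`.

§8(d): uses an L-value-free non-vanishing device: NO.
-/

open NumberField NumberField.IsCMField IsDedekindDomain IsDedekindDomain.HeightOneSpectrum Module Polynomial
  MulAction
open scoped TensorProduct Pointwise
open Summit.Ventures.HodgeRepro2.T5UnitaryGroupForm Summit.Ventures.HodgeRepro2.T5UnitaryHeckeAdjoint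
  Summit.Ventures.HodgeRepro2.T5HeckePermutationModule Summit.Ventures.HodgeRepro2.T5HeckeDoubleCoset
  Summit.Ventures.HodgeRepro2.T5RecordHyperspecial Summit.Ventures.HodgeRepro2.T5RecordSatakeToy
  Summit.Ventures.HodgeRepro2.T5SplitPlaceUnitaryGroup Summit.Ventures.HodgeRepro2.T5CyclotomicSevenInertThree
  Summit.Ventures.HodgeRepro2.T5CyclotomicSevenInertPrime Summit.Ventures.HodgeRepro2.T5FinitePlaceCM
  Summit.Ventures.HodgeRepro2.T5StarOfInvolution Summit.Ventures.HodgeRepro2.T5NonSplitPlaceUnitaryGroup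
  Summit.Ventures.HodgeRepro2.T5GlobalLatticeAlmostAll Summit.Ventures.HodgeRepro2.T5FinitePlaceSplitClassification
  Summit.Ventures.HodgeRepro2.T5CyclotomicSevenDegreeOnePrime Summit.Ventures.HodgeRepro2.T5RecordSatakeSevenDegreeOne

namespace Summit.Ventures.HodgeRepro2.T5CyclotomicSevenDegreeOneInfinitelyMany

section Dirichlet

/-- `6` has multiplicative order `2` modulo `7`. -/
theorem orderOf_six_zmod_seven : orderOf (6 : ZMod 7) = 2 := by
  rw [orderOf_eq_iff (by norm_num)]
  decide

/-- **Infinitely many primes of order `2` modulo `7`** (Dirichlet for the class of `6 ≡ −1`). -/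
theorem infinite_setOf_prime_and_orderOf_eq_two : {p : ℕ | p.Prime ∧ orderOf (p : ZMod 7) = 2}.Infinite := by
  have hu : IsUnit ((6 : ℕ) : ZMod 7) := ⟨ZMod.unitOfCoprime 6 (by norm_num), rfl⟩
  refine (Nat.infinite_setOf_prime_and_eq_mod hu).mono ?_
  intro p hp
  refine ⟨hp.1, ?_⟩
  rw [hp.2, Nat.cast_ofNat]
  exact orderOf_six_zmod_seven

end Dirichlet

section Seven

variable (K : Type*) [Field K] [CharZero K] [IsCyclotomicExtension {7} ℚ K]

/-- A chosen prime of `𝓞_{ℚ(ζ₇)⁺}` above a rational prime `p`. -/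
noncomputable def primeAbove (p : ℕ) [hp : Fact p.Prime] :
    (Ideal.span {(p : ℤ)}).primesOver (𝓞 (maximalRealSubfield K)) :=
  haveI := numberField' K
  haveI : (Ideal.span {(p : ℤ)}).IsPrime :=
    (Ideal.span_singleton_prime (Nat.cast_ne_zero.mpr hp.out.ne_zero)).mpr (Nat.prime_iff_prime_int.mp hp.out)
  (Ideal.nonempty_primesOver (S := 𝓞 (maximalRealSubfield K)) (Ideal.span {(p : ℤ)})).some

omit [IsCyclotomicExtension {7} ℚ K] in
/-- The chosen prime is prime. -/
theorem primeAbove_isPrime (p : ℕ) [hp : Fact p.Prime] : (primeAbove K p).1.IsPrime := (primeAbove K p).2.1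

omit [IsCyclotomicExtension {7} ℚ K] in
/-- The chosen prime lies above `p`. -/
theorem primeAbove_liesOver (p : ℕ) [hp : Fact p.Prime] : (primeAbove K p).1.LiesOver (Ideal.span {(p : ℤ)}) :=
  (primeAbove K p).2.2

omit [IsCyclotomicExtension {7} ℚ K] in
/-- The chosen prime is not `⊥`. -/
theorem primeAbove_ne_bot (p : ℕ) [hp : Fact p.Prime] : (primeAbove K p).1 ≠ ⊥ :=
  haveI := primeAbove_liesOver K p
  Ideal.ne_bot_of_liesOver_of_ne_bot
    ((Ideal.span_singleton_eq_bot).not.mpr (Nat.cast_ne_zero.mpr hp.out.ne_zero) : Ideal.span {(p : ℤ)} ≠ ⊥)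
    (primeAbove K p).1

/-- **A chosen degree-one place of `ℚ(ζ₇)⁺` above each prime `p` of order `2` modulo `7`.** -/
noncomputable def vDegOneOf (p : {p : ℕ // p.Prime ∧ orderOf (p : ZMod 7) = 2}) :
    HeightOneSpectrum (𝓞 (maximalRealSubfield K)) :=
  haveI : Fact p.1.Prime := ⟨p.2.1⟩
  { asIdeal := (primeAbove K p.1).1
    isPrime := primeAbove_isPrime K p.1
    ne_bot := primeAbove_ne_bot K p.1 }

omit [IsCyclotomicExtension {7} ℚ K] in
/-- The ideal of `vDegOneOf`. -/
theorem vDegOneOf_asIdeal (p : {p : ℕ // p.Prime ∧ orderOf (p : ZMod 7) = 2}) :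
    (vDegOneOf K p).asIdeal = (primeAbove K p.1 (hp := ⟨p.2.1⟩)).1 := rfl

omit [IsCyclotomicExtension {7} ℚ K] in
/-- `vDegOneOf p` lies above `p`. -/
theorem liesOver_vDegOneOf (p : {p : ℕ // p.Prime ∧ orderOf (p : ZMod 7) = 2}) :
    (vDegOneOf K p).asIdeal.LiesOver (Ideal.span {(p.1 : ℤ)}) :=
  primeAbove_liesOver K p.1 (hp := ⟨p.2.1⟩)

/-- **`N(vDegOneOf p) = p`.** -/
theorem absNorm_vDegOneOf (p : {p : ℕ // p.Prime ∧ orderOf (p : ZMod 7) = 2}) :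
    haveI := numberField' K; haveI := isCMField' K
    Ideal.absNorm (vDegOneOf K p).asIdeal = p.1 :=
  haveI := numberField' K
  haveI := isCMField' K
  absNorm_eq K p.1 (hp := ⟨p.2.1⟩) p.2.2 (vDegOneOf K p) (hv := liesOver_vDegOneOf K p)

/-- **`vDegOneOf p` stays prime in `ℚ(ζ₇)`.** -/
theorem exists_map_vDegOneOf (p : {p : ℕ // p.Prime ∧ orderOf (p : ZMod 7) = 2}) :
    haveI := numberField' K; haveI := isCMField' K
    ∃ w : HeightOneSpectrum (𝓞 K),
      Ideal.map (algebraMap (𝓞 (maximalRealSubfield K)) (𝓞 K)) (vDegOneOf K p).asIdeal = w.asIdeal :=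
  haveI := numberField' K
  haveI := isCMField' K
  (exists_liesOver_and_map_eq K p.1 (hp := ⟨p.2.1⟩) p.2.2 (vDegOneOf K p) (hv := liesOver_vDegOneOf K p)).elim
    fun w h => ⟨w, h.2⟩

/-- Distinct primes give distinct degree-one places (`N(vDegOneOf p) = p`). -/
theorem vDegOneOf_injective :
    haveI := numberField' K; haveI := isCMField' K
    Function.Injective (vDegOneOf K) := by
  haveI := numberField' K
  haveI := isCMField' K
  intro p q h
  have hp := absNorm_vDegOneOf K p
  have hq := absNorm_vDegOneOf K q
  have h' : (vDegOneOf K p).asIdeal = (vDegOneOf K q).asIdeal := by rw [h]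
  refine Subtype.ext ?_
  rw [← hp, ← hq]
  exact h'.symm ▸ rfl

/-- **Infinitely many places of `ℚ(ζ₇)⁺` of PRIME norm stay prime in `ℚ(ζ₇)`** — the degree-one inert places of the
field of record. -/
theorem infinite_setOf_staysPrime_and_absNorm_prime :
    haveI := numberField' K; haveI := isCMField' K
    {v : HeightOneSpectrum (𝓞 (maximalRealSubfield K)) | (Ideal.absNorm v.asIdeal).Prime ∧
      ∃ w : HeightOneSpectrum (𝓞 K),
        Ideal.map (algebraMap (𝓞 (maximalRealSubfield K)) (𝓞 K)) v.asIdeal = w.asIdeal}.Infinite := by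
  haveI := numberField' K
  haveI := isCMField' K
  haveI : Infinite {p : ℕ // p.Prime ∧ orderOf (p : ZMod 7) = 2} :=
    infinite_setOf_prime_and_orderOf_eq_two.to_subtype
  exact Set.infinite_of_injective_forall_mem (vDegOneOf_injective K) fun p =>
    ⟨by rw [absNorm_vDegOneOf K p]; exact p.2.1, exists_map_vDegOneOf K p⟩

/-- **At infinitely many places `v` of `ℚ(ζ₇)⁺` of prime norm the record's spherical Hecke algebra
`H(U(1 ⊗ H₀), K_v)` is `k[X]`**, for every family `l` of generators of `𝓞_{ℚ(ζ₇)}` over `𝓞_{ℚ(ζ₇)⁺}`. -/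
theorem infinite_setOf_nonempty_algEquiv_polynomial_and_absNorm_prime (k : Type*) [Field k] :
    haveI := numberField' K; haveI := isCMField' K
    {v : HeightOneSpectrum (𝓞 (maximalRealSubfield K)) | (Ideal.absNorm v.asIdeal).Prime ∧
      ∀ {r : ℕ} (l : Fin r → 𝓞 K), Submodule.span (𝓞 (maximalRealSubfield K)) (Set.range l) = ⊤ →
        Nonempty (Polynomial k ≃ₐ[k]
          (letI := tensorStarRing K v; ↥(heckeAlgebra k (recordHyperspecial K v l (gramToy K)))))}.Infinite := by
  haveI := numberField' K
  haveI := isCMField' K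
  haveI : Infinite {p : ℕ // p.Prime ∧ orderOf (p : ZMod 7) = 2} :=
    infinite_setOf_prime_and_orderOf_eq_two.to_subtype
  exact Set.infinite_of_injective_forall_mem (vDegOneOf_injective K) fun p =>
    ⟨by rw [absNorm_vDegOneOf K p]; exact p.2.1, fun {r} l hl =>
      nonempty_algEquiv_polynomial_record_seven_degree_one K p.1 (hp := ⟨p.2.1⟩) p.2.2 (vDegOneOf K p)
        (hv := liesOver_vDegOneOf K p) k l hl⟩

end Seven

end Summit.Ventures.HodgeRepro2.T5CyclotomicSevenDegreeOneInfinitelyMany
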